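import Literature.NumberTheory.LFunctions.Zhang2022.MainTermFormPSD

/-!
# The main-term form `𝔅` on `H¹` (kinked) profiles

Companion to `MainTermFormPSD` (repair cell `pub-zhang`, autopsy of Y. Zhang, *Discrete mean
estimates and the Landau–Siegel zero*, arXiv:2211.02515 (2022) [Zhang2022LandauSiegel]; the
cell's verdict on that manuscript is NEGATIVE — the printed inequality (8.24) fails,
`Zhang2022.not_ineq824` — and this file makes no claim about its Theorems 1–2).

`MainTermFormPSD.mainTermForm_nonneg` proves `𝔅(g,g) ≥ 0` for the glued main-term Hermitian form
`𝔅` (`mainTermForm`, STRUCTURE.md (4.1) of the cell, `mainTermForm_eq`) on `C¹` profiles `g`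
(`IsC1OnUnitInterval`). The profiles to which the cell applies `𝔅` (STRUCTURE.md §§4–5: the
manuscript's mollifier profiles, continuous and piecewise poly×exp in the logarithmic variable,
with kinks at the gluing points) are `H¹`, not `C¹`. This file supplies the `H¹` statement (the
cell's pen proof PROOF-O15 covers `H¹` "by density"):

* `IsH1OnUnitInterval g g'` — `g′ ∈ L²(0,1)` and `g(y) = g(0) + ∫₀ʸ g′` on `[0,1]`; every `C¹`
  profile is one (`IsC1OnUnitInterval.isH1`), and so is every `g` continuous on `[0,1]` with a
  right derivative `g′(x)` at each interior point and `g′ ∈ L²(0,1)` — kinks allowed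
  (`isH1_of_hasDerivWithinAt_Ioi`, FTC-2 with right derivatives);
* `mainTermForm_nonneg_of_isH1` — **`0 ≤ 𝔅(g,g)` for every `H¹` profile**; corollaries
  `mainTermForm_nonneg_of_hasDerivWithinAt_Ioi` and `mainTermForm_nonneg_of_bounded_rightDeriv`
  (continuous, right-differentiable inside, bounded a.e.-measurable right derivative).

## Proof

Density of continuous functions in `L²(0,1)` (Mathlib's
`MemLp.exists_boundedContinuous_integral_rpow_sub_le`) gives continuous `hₙ` with
`eₙ = ∫₀¹ ‖hₙ − g′‖² → 0`; `Gₙ(y) = g(0) + ∫₀ʸ hₙ` is a `C¹` profile with `Gₙ′ = hₙ`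
(`isC1_const_add_primitive`), so `𝔅(Gₙ,Gₙ) ≥ 0`. With `dₙ = ∫₀¹ ‖hₙ − g′‖ ≤ √eₙ`
(`sq_integral_norm_le_unit`, Jensen on `[0,1]`) one has `‖Gₙ − g‖_∞ ≤ dₙ` and `‖Sₙ − S‖_∞ ≤ dₙ`
for the primitives, and each of the six terms of (4.1) converges — the sesquilinear ones by
`tendsto_intervalIntegral_mul_conj` (`L¹ × uniform`), the `‖g′‖²` term by the pointwise bound
`|‖hₙ‖² − ‖g′‖²| ≤ (1 + 1/t)‖hₙ − g′‖² + t‖g′‖²` with `t = tₙ = √eₙ + 1/(n+1) → 0` — whence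
`𝔅(Gₙ,Gₙ) → 𝔅(g,g)` and `𝔅(g,g) ≥ 0` (`ge_of_tendsto'`). Elementary; all declarations are
tagged `[folklore]`.

NOT here: the kernel of `𝔅` on `H¹` (for `C¹` profiles: `MainTermFormPSD.mainTermForm_eq_zero_iff`
and its span form), and the sum-of-squares identity `𝔅 = (8/π) Σ_k w_k |c_k(R₁)|²` on `H¹`.
-/

noncomputable section

open MeasureTheory Set intervalIntegral Filter
open scoped Real ComplexConjugate Topology

namespace Literature.NumberTheory.LFunctions.Zhang2022

/-! ### `H¹` profiles on `[0,1]` -/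

/-- `g ∈ H¹(0,1)` with marked (weak) derivative `g′ ∈ L²(0,1)`: `g(y) = g(0) + ∫₀ʸ g′` on
`[0,1]` (so `g` is absolutely continuous and `g′` is its a.e. derivative). [folklore] -/
structure IsH1OnUnitInterval (g g' : ℝ → ℂ) : Prop where
  memLp : MemLp g' 2 (volume.restrict (Ioc (0:ℝ) 1))
  eq_add_integral : ∀ y ∈ Icc (0:ℝ) 1, g y = g 0 + ∫ t in (0:ℝ)..y, g' t

variable {g g' : ℝ → ℂ}

/-- Restriction of interval integrability from `[0,1]` to `[0,x]`. [folklore] -/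
theorem intervalIntegrable_mono_unit {E : Type*} [NormedAddCommGroup E] {f : ℝ → E}
    (hf : IntervalIntegrable f volume 0 1) {x : ℝ} (hx : x ∈ Icc (0:ℝ) 1) :
    IntervalIntegrable f volume 0 x :=
  hf.mono_set (by rw [uIcc_of_le hx.1, uIcc_of_le zero_le_one]; exact Icc_subset_Icc_right hx.2)

/-- `‖∫₀ˣ f‖ ≤ C` on `[0,1]` when `‖f‖ ≤ C` on `[0,1]`. [folklore] -/
theorem norm_integral_le_of_le_unit {f : ℝ → ℂ} {C : ℝ} (hC0 : 0 ≤ C)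
    (hC : ∀ t ∈ Icc (0:ℝ) 1, ‖f t‖ ≤ C) {x : ℝ} (hx : x ∈ Icc (0:ℝ) 1) :
    ‖∫ t in (0:ℝ)..x, f t‖ ≤ C := by
  calc ‖∫ t in (0:ℝ)..x, f t‖ ≤ C * |x - 0| :=
        intervalIntegral.norm_integral_le_of_norm_le_const fun t ht => by
          rw [uIoc_of_le hx.1] at ht
          exact hC t ⟨ht.1.le, ht.2.trans hx.2⟩
    _ ≤ C := by
        rw [sub_zero, abs_of_nonneg hx.1]
        exact mul_le_of_le_one_right hC0 hx.2

/-- `g′` is integrable on `[0,1]`. [folklore] -/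
theorem IsH1OnUnitInterval.intervalIntegrable (hg : IsH1OnUnitInterval g g') :
    IntervalIntegrable g' volume 0 1 := by
  rw [intervalIntegrable_iff, uIoc_of_le zero_le_one]
  exact hg.memLp.integrable one_le_two

/-- `‖g′‖²` is integrable on `[0,1]`. [folklore] -/
theorem IsH1OnUnitInterval.intervalIntegrable_sq (hg : IsH1OnUnitInterval g g') :
    IntervalIntegrable (fun x => ‖g' x‖ ^ 2) volume 0 1 := by
  rw [intervalIntegrable_iff, uIoc_of_le zero_le_one]
  exact (memLp_two_iff_integrable_sq_norm hg.memLp.1).1 hg.memLp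

/-- An `H¹` profile is continuous on `[0,1]`. [folklore] -/
theorem IsH1OnUnitInterval.continuousOn (hg : IsH1OnUnitInterval g g') :
    ContinuousOn g (Icc 0 1) := by
  have hint : IntegrableOn g' (uIcc 0 1) volume := by
    rw [uIcc_of_le zero_le_one, integrableOn_Icc_iff_integrableOn_Ioc]
    exact hg.memLp.integrable one_le_two
  have h2 := intervalIntegral.continuousOn_primitive_interval hint
  rw [uIcc_of_le zero_le_one] at h2
  exact (continuousOn_const.add h2).congr fun y hy => hg.eq_add_integral y hy

/-- A `C¹` profile is an `H¹` profile. [folklore] -/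
theorem IsC1OnUnitInterval.isH1 (hg : IsC1OnUnitInterval g g') : IsH1OnUnitInterval g g' where
  memLp := by
    have hmeas : AEStronglyMeasurable g' (volume.restrict (Ioc (0:ℝ) 1)) :=
      (hg.cont'.mono Ioc_subset_Icc_self).aestronglyMeasurable measurableSet_Ioc
    rw [memLp_two_iff_integrable_sq_norm hmeas]
    have hc : ContinuousOn (fun x => ‖g' x‖ ^ 2) (Icc 0 1) := (hg.cont'.norm).pow 2
    exact hc.integrableOn_Icc.mono_set Ioc_subset_Icc_self
  eq_add_integral := fun y hy => by
    have hcont : ContinuousOn g (Icc 0 y) := hg.cont.mono (Icc_subset_Icc_right hy.2)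
    have hderiv : ∀ x ∈ Ioo (0:ℝ) y, HasDerivAt g (g' x) x :=
      fun x hx => hg.hasDeriv x ⟨hx.1, hx.2.trans_le hy.2⟩
    have hint : IntervalIntegrable g' volume 0 y :=
      (hg.cont'.mono (Icc_subset_Icc_right hy.2)).intervalIntegrable_of_Icc hy.1
    rw [intervalIntegral.integral_eq_sub_of_hasDerivAt_of_le hy.1 hcont hderiv hint]
    ring

/-- Kinked profiles: `g` continuous on `[0,1]` with a RIGHT derivative `g′(x)` at every interior
point and `g′ ∈ L²(0,1)` is an `H¹` profile (covers continuous piecewise-`C¹` profiles). [folklore] -/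
theorem isH1_of_hasDerivWithinAt_Ioi (hc : ContinuousOn g (Icc 0 1))
    (hd : ∀ x ∈ Ioo (0:ℝ) 1, HasDerivWithinAt g (g' x) (Ioi x) x)
    (hm : MemLp g' 2 (volume.restrict (Ioc (0:ℝ) 1))) : IsH1OnUnitInterval g g' where
  memLp := hm
  eq_add_integral := fun y hy => by
    have hint1 : IntervalIntegrable g' volume 0 1 := by
      rw [intervalIntegrable_iff, uIoc_of_le zero_le_one]; exact hm.integrable one_le_two
    rw [intervalIntegral.integral_eq_sub_of_hasDeriv_right_of_le hy.1
      (hc.mono (Icc_subset_Icc_right hy.2)) (fun x hx => hd x ⟨hx.1, hx.2.trans_le hy.2⟩)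
      (intervalIntegrable_mono_unit hint1 hy)]
    ring

/-! ### Density of continuous functions and elementary estimates -/

/-- `L²` density of continuous functions, in the form used here. [folklore] -/
theorem IsH1OnUnitInterval.exists_continuous_approx (hg : IsH1OnUnitInterval g g') {ε : ℝ}
    (hε : 0 < ε) :
    ∃ h : ℝ → ℂ, Continuous h ∧ MemLp h 2 (volume.restrict (Ioc (0:ℝ) 1)) ∧
      ∫ x in (0:ℝ)..1, ‖h x - g' x‖ ^ 2 ≤ ε := by
  have h2 : MemLp g' (ENNReal.ofReal 2) (volume.restrict (Ioc (0:ℝ) 1)) := by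
    rw [ENNReal.ofReal_ofNat]; exact hg.memLp
  obtain ⟨h, hh, hmem⟩ := h2.exists_boundedContinuous_integral_rpow_sub_le zero_lt_two hε
  rw [ENNReal.ofReal_ofNat] at hmem
  refine ⟨h, h.continuous, hmem, ?_⟩
  rw [intervalIntegral.integral_of_le zero_le_one]
  have e : (fun x => ‖h x - g' x‖ ^ 2) = fun x => ‖g' x - h x‖ ^ (2:ℝ) := by
    ext x; rw [Real.rpow_two, norm_sub_rev]
  rw [e]; exact hh

/-- Jensen on the unit interval: `(∫₀¹ ‖u‖)² ≤ ∫₀¹ ‖u‖²`. [folklore] -/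
theorem sq_integral_norm_le_unit {u : ℝ → ℂ} (hu : IntervalIntegrable u volume 0 1)
    (hu2 : IntervalIntegrable (fun x => ‖u x‖ ^ 2) volume 0 1) :
    (∫ x in (0:ℝ)..1, ‖u x‖) ^ 2 ≤ ∫ x in (0:ℝ)..1, ‖u x‖ ^ 2 := by
  set m := ∫ x in (0:ℝ)..1, ‖u x‖ with hm
  have h1 : IntervalIntegrable (fun x => ‖u x‖) volume 0 1 := hu.norm
  have h3 : IntervalIntegrable (fun x => 2 * m * ‖u x‖) volume 0 1 := h1.const_mul _
  have h4 : IntervalIntegrable (fun _ => m ^ 2) volume (0:ℝ) 1 := intervalIntegrable_const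
  have key : ∫ x in (0:ℝ)..1, (‖u x‖ - m) ^ 2 = (∫ x in (0:ℝ)..1, ‖u x‖ ^ 2) - m ^ 2 := by
    have e : ∀ x, (‖u x‖ - m) ^ 2 = ‖u x‖ ^ 2 - 2 * m * ‖u x‖ + m ^ 2 := fun x => by ring
    simp_rw [e]
    rw [intervalIntegral.integral_add (hu2.sub h3) h4, intervalIntegral.integral_sub hu2 h3,
      intervalIntegral.integral_const_mul, intervalIntegral.integral_const]
    simp only [sub_zero, smul_eq_mul, one_mul]
    ring
  have hnn : 0 ≤ ∫ x in (0:ℝ)..1, (‖u x‖ - m) ^ 2 :=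
    intervalIntegral.integral_nonneg zero_le_one fun x _ => sq_nonneg _
  linarith

/-- The `C¹` profile `G(y) = a + ∫₀ʸ h` built from a continuous `h`. [folklore] -/
theorem isC1_const_add_primitive {h : ℝ → ℂ} (hh : Continuous h) (a : ℂ) :
    IsC1OnUnitInterval (fun y => a + ∫ t in (0:ℝ)..y, h t) h where
  cont := (continuous_const.add
    (intervalIntegral.continuous_primitive (fun _ _ => hh.intervalIntegrable _ _) 0)).continuousOn
  cont' := hh.continuousOn
  hasDeriv := fun x _ => ((hh.integral_hasStrictDerivAt 0 x).hasDerivAt).const_add a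

/-- Uniform closeness of `g(0) + ∫₀ʸ h` to `g`: `≤ ∫₀¹ ‖h − g′‖`. [folklore] -/
theorem norm_primitive_sub_le (hg : IsH1OnUnitInterval g g') {h : ℝ → ℂ} (hh : Continuous h)
    {y : ℝ} (hy : y ∈ Icc (0:ℝ) 1) :
    ‖(g 0 + ∫ t in (0:ℝ)..y, h t) - g y‖ ≤ ∫ x in (0:ℝ)..1, ‖h x - g' x‖ := by
  have hgy : IntervalIntegrable g' volume 0 y := intervalIntegrable_mono_unit hg.intervalIntegrable hy
  have hhy : IntervalIntegrable h volume 0 y := hh.intervalIntegrable _ _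
  have hI : IntervalIntegrable (fun t => ‖h t - g' t‖) volume 0 1 :=
    ((hh.intervalIntegrable 0 1).sub hg.intervalIntegrable).norm
  rw [hg.eq_add_integral y hy, add_sub_add_left_eq_sub, ← intervalIntegral.integral_sub hhy hgy]
  calc ‖∫ t in (0:ℝ)..y, (h t - g' t)‖ ≤ ∫ t in (0:ℝ)..y, ‖h t - g' t‖ :=
        intervalIntegral.norm_integral_le_integral_norm hy.1
    _ ≤ ∫ t in (0:ℝ)..1, ‖h t - g' t‖ :=
        intervalIntegral.integral_mono_interval le_rfl hy.1 hy.2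
          (Eventually.of_forall fun _ => norm_nonneg _) hI

/-! ### Passage to the limit -/

/-- `L¹` convergence gives convergence of integrals. [folklore] -/
theorem tendsto_intervalIntegral_of_norm_sub_le {u : ℕ → ℝ → ℂ} {U : ℝ → ℂ} {α : ℕ → ℝ}
    (hu : ∀ n, IntervalIntegrable (u n) volume 0 1) (hU : IntervalIntegrable U volume 0 1)
    (hα : ∀ n, ∫ x in (0:ℝ)..1, ‖u n x - U x‖ ≤ α n) (hα0 : Tendsto α atTop (𝓝 0)) :
    Tendsto (fun n => ∫ x in (0:ℝ)..1, u n x) atTop (𝓝 (∫ x in (0:ℝ)..1, U x)) := by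
  rw [tendsto_iff_norm_sub_tendsto_zero]
  refine squeeze_zero (fun n => norm_nonneg _) (fun n => ?_) hα0
  rw [← intervalIntegral.integral_sub (hu n) hU]
  exact (intervalIntegral.norm_integral_le_integral_norm zero_le_one).trans (hα n)

/-- `∫₀¹ uₙ · conj vₙ → ∫₀¹ U · conj V` when `uₙ → U` in `L¹` and `vₙ → V` uniformly with
`vₙ, V` continuous. [folklore] -/
theorem tendsto_intervalIntegral_mul_conj {u v : ℕ → ℝ → ℂ} {U V : ℝ → ℂ} {α β : ℕ → ℝ}
    {B : ℝ} (hu : ∀ n, IntervalIntegrable (u n) volume 0 1) (hU : IntervalIntegrable U volume 0 1)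
    (hv : ∀ n, ContinuousOn (v n) (Icc 0 1)) (hV : ContinuousOn V (Icc 0 1))
    (hα : ∀ n, ∫ x in (0:ℝ)..1, ‖u n x - U x‖ ≤ α n) (hα0 : Tendsto α atTop (𝓝 0))
    (hβ : ∀ n, ∀ x ∈ Icc (0:ℝ) 1, ‖v n x - V x‖ ≤ β n) (hβ0 : Tendsto β atTop (𝓝 0))
    (hB : ∀ x ∈ Icc (0:ℝ) 1, ‖V x‖ ≤ B) :
    Tendsto (fun n => ∫ x in (0:ℝ)..1, u n x * conj (v n x)) atTop
      (𝓝 (∫ x in (0:ℝ)..1, U x * conj (V x))) := by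
  have h0 : (0:ℝ) ∈ Icc (0:ℝ) 1 := left_mem_Icc.2 zero_le_one
  have hβnn : ∀ n, 0 ≤ β n := fun n => (norm_nonneg _).trans (hβ n 0 h0)
  set N := ∫ x in (0:ℝ)..1, ‖U x‖ with hN
  have icc : uIcc (0:ℝ) 1 = Icc 0 1 := uIcc_of_le zero_le_one
  have hcv : ∀ n, ContinuousOn (fun x => conj (v n x)) (uIcc 0 1) :=
    fun n => icc ▸ continuousOn_conj_comp (hv n)
  have hcV : ContinuousOn (fun x => conj (V x)) (uIcc 0 1) := icc ▸ continuousOn_conj_comp hV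
  have iuv : ∀ n, IntervalIntegrable (fun x => u n x * conj (v n x)) volume 0 1 :=
    fun n => (hu n).mul_continuousOn (hcv n)
  have iUV : IntervalIntegrable (fun x => U x * conj (V x)) volume 0 1 := hU.mul_continuousOn hcV
  refine tendsto_intervalIntegral_of_norm_sub_le iuv iUV
    (α := fun n => (B + β n) * α n + β n * N) (fun n => ?_) ?_
  · have hpt : ∀ x ∈ Icc (0:ℝ) 1, ‖u n x * conj (v n x) - U x * conj (V x)‖
        ≤ (B + β n) * ‖u n x - U x‖ + β n * ‖U x‖ := by
      intro x hx
      have e : u n x * conj (v n x) - U x * conj (V x)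
          = (u n x - U x) * conj (v n x) + U x * (conj (v n x) - conj (V x)) := by ring
      rw [e]
      refine (norm_add_le _ _).trans (add_le_add ?_ ?_)
      · rw [norm_mul, mul_comm, Complex.norm_conj]
        refine mul_le_mul_of_nonneg_right ?_ (norm_nonneg _)
        calc ‖v n x‖ = ‖V x + (v n x - V x)‖ := by rw [add_sub_cancel]
          _ ≤ ‖V x‖ + ‖v n x - V x‖ := norm_add_le _ _
          _ ≤ B + β n := add_le_add (hB x hx) (hβ n x hx)
      · rw [norm_mul, mul_comm, ← map_sub, Complex.norm_conj]
        exact mul_le_mul_of_nonneg_right (hβ n x hx) (norm_nonneg _)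
    have i1 : IntervalIntegrable (fun x => (B + β n) * ‖u n x - U x‖ + β n * ‖U x‖) volume 0 1 :=
      (((hu n).sub hU).norm.const_mul _).add (hU.norm.const_mul _)
    calc ∫ x in (0:ℝ)..1, ‖u n x * conj (v n x) - U x * conj (V x)‖
        ≤ ∫ x in (0:ℝ)..1, ((B + β n) * ‖u n x - U x‖ + β n * ‖U x‖) :=
          intervalIntegral.integral_mono_on zero_le_one ((iuv n).sub iUV).norm i1 hpt
      _ = (B + β n) * (∫ x in (0:ℝ)..1, ‖u n x - U x‖) + β n * N := by
          rw [intervalIntegral.integral_add (((hu n).sub hU).norm.const_mul _) (hU.norm.const_mul _),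
            intervalIntegral.integral_const_mul, intervalIntegral.integral_const_mul]
      _ ≤ (B + β n) * α n + β n * N := by
          have hB0 : 0 ≤ B := (norm_nonneg _).trans (hB 0 h0)
          have := mul_le_mul_of_nonneg_left (hα n) (add_nonneg hB0 (hβnn n))
          linarith
  · have : Tendsto (fun n => (B + β n) * α n + β n * N) atTop (𝓝 ((B + 0) * 0 + 0 * N)) :=
      ((tendsto_const_nhds.add hβ0).mul hα0).add (hβ0.mul tendsto_const_nhds)
    simpa using this


/-- Continuity of `x ↦ ∫₀ˣ f` on `[0,1]` for `f` continuous on `[0,1]`. [folklore] -/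
theorem continuousOn_primitive_unit {f : ℝ → ℂ} (hf : ContinuousOn f (Icc 0 1)) :
    ContinuousOn (fun x => ∫ t in (0:ℝ)..x, f t) (Icc 0 1) := by
  have hint : IntegrableOn f (uIcc 0 1) volume := by
    rw [uIcc_of_le zero_le_one]; exact hf.integrableOn_Icc
  have := intervalIntegral.continuousOn_primitive_interval hint
  rwa [uIcc_of_le zero_le_one] at this

/-! ### The main-term form on `H¹` profiles -/

/-- **O15 on `H¹`: `𝔅(g,g) ≥ 0` for every `H¹` profile** — in particular for the manuscript's
continuous piecewise poly×exp (kinked) profiles — by `L²`-density of `C¹` profiles and continuity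
of each term of (4.1) (`mainTermForm_eq`). [folklore] -/
theorem mainTermForm_nonneg_of_isH1 (hg : IsH1OnUnitInterval g g') : 0 ≤ mainTermForm g g' := by
  have h0 : (0:ℝ) ∈ Icc (0:ℝ) 1 := left_mem_Icc.2 zero_le_one
  have h1 : (1:ℝ) ∈ Icc (0:ℝ) 1 := right_mem_Icc.2 zero_le_one
  -- data about `g`
  have hgc : ContinuousOn g (Icc 0 1) := hg.continuousOn
  have hgi : IntervalIntegrable g volume 0 1 := hgc.intervalIntegrable_of_Icc zero_le_one
  have hg'i : IntervalIntegrable g' volume 0 1 := hg.intervalIntegrable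
  obtain ⟨B₀, hB₀⟩ := isCompact_Icc.exists_bound_of_continuousOn hgc
  have hB : ∀ x ∈ Icc (0:ℝ) 1, ‖g x‖ ≤ max B₀ 0 := fun x hx => (hB₀ x hx).trans (le_max_left _ _)
  have hB0 : 0 ≤ max B₀ 0 := le_max_right _ _
  -- the approximants `hₙ → g′` in `L²`
  have hex : ∀ n : ℕ, ∃ h : ℝ → ℂ, Continuous h ∧ MemLp h 2 (volume.restrict (Ioc (0:ℝ) 1)) ∧
      ∫ x in (0:ℝ)..1, ‖h x - g' x‖ ^ 2 ≤ 1 / ((n:ℝ) + 1) :=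
    fun n => hg.exists_continuous_approx (by positivity)
  choose h hc hm he using hex
  obtain ⟨e, he_def⟩ : ∃ e : ℕ → ℝ, ∀ n, e n = ∫ x in (0:ℝ)..1, ‖h n x - g' x‖ ^ 2 :=
    ⟨_, fun _ => rfl⟩
  obtain ⟨d, hd_def⟩ : ∃ d : ℕ → ℝ, ∀ n, d n = ∫ x in (0:ℝ)..1, ‖h n x - g' x‖ :=
    ⟨_, fun _ => rfl⟩
  have hhi : ∀ n, IntervalIntegrable (h n) volume 0 1 := fun n => (hc n).intervalIntegrable 0 1
  have hdi : ∀ n, IntervalIntegrable (fun x => h n x - g' x) volume 0 1 := fun n => (hhi n).sub hg'i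
  have hei : ∀ n, IntervalIntegrable (fun x => ‖h n x - g' x‖ ^ 2) volume 0 1 := by
    intro n
    rw [intervalIntegrable_iff, uIoc_of_le zero_le_one]
    have hm2 : MemLp (fun x => h n x - g' x) 2 (volume.restrict (Ioc (0:ℝ) 1)) :=
      (hm n).sub hg.memLp
    exact (memLp_two_iff_integrable_sq_norm hm2.1).1 hm2
  have he0 : ∀ n, 0 ≤ e n := fun n => by
    rw [he_def]; exact intervalIntegral.integral_nonneg zero_le_one fun x _ => sq_nonneg _
  have hd0 : ∀ n, 0 ≤ d n := fun n => by
    rw [hd_def]; exact intervalIntegral.integral_nonneg zero_le_one fun x _ => norm_nonneg _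
  have he_t : Tendsto e atTop (𝓝 0) :=
    squeeze_zero he0 (fun n => (he_def n).le.trans (he n)) tendsto_one_div_add_atTop_nhds_zero_nat
  have hsqrt_t : Tendsto (fun n => Real.sqrt (e n)) atTop (𝓝 0) := by
    have := (Real.continuous_sqrt.tendsto 0).comp he_t
    rw [Real.sqrt_zero] at this
    exact this
  have hd_le : ∀ n, d n ≤ Real.sqrt (e n) := fun n => by
    rw [Real.le_sqrt (hd0 n) (he0 n), hd_def, he_def]
    exact sq_integral_norm_le_unit (hdi n) (hei n)
  have hd_t : Tendsto d atTop (𝓝 0) := squeeze_zero hd0 hd_le hsqrt_t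
  -- the `C¹` approximants `Gₙ = g(0) + ∫₀ hₙ → g` uniformly
  obtain ⟨G, hG_def⟩ : ∃ G : ℕ → ℝ → ℂ, ∀ n, G n = fun y => g 0 + ∫ t in (0:ℝ)..y, h n t :=
    ⟨_, fun _ => rfl⟩
  have hGC1 : ∀ n, IsC1OnUnitInterval (G n) (h n) := fun n => by
    rw [hG_def]; exact isC1_const_add_primitive (hc n) (g 0)
  have hGc : ∀ n, ContinuousOn (G n) (Icc 0 1) := fun n => (hGC1 n).cont
  have hGi : ∀ n, IntervalIntegrable (G n) volume 0 1 :=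
    fun n => (hGc n).intervalIntegrable_of_Icc zero_le_one
  have hG0 : ∀ n, G n 0 = g 0 := fun n => by simp [hG_def]
  have hGg : ∀ n, ∀ y ∈ Icc (0:ℝ) 1, ‖G n y - g y‖ ≤ d n := fun n y hy => by
    rw [hG_def, hd_def]; exact norm_primitive_sub_le hg (hc n) hy
  have hGg1 : ∀ n, ∫ x in (0:ℝ)..1, ‖G n x - g x‖ ≤ d n := fun n => by
    calc ∫ x in (0:ℝ)..1, ‖G n x - g x‖ ≤ ∫ x in (0:ℝ)..1, d n :=
          intervalIntegral.integral_mono_on zero_le_one ((hGi n).sub hgi).norm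
            intervalIntegrable_const (hGg n)
      _ = d n := by simp
  -- the primitives `Sₙ = ∫₀ Gₙ → S = ∫₀ g` uniformly
  have hSc : ContinuousOn (fun x => ∫ t in (0:ℝ)..x, g t) (Icc 0 1) := continuousOn_primitive_unit hgc
  have hSnc : ∀ n, ContinuousOn (fun x => ∫ t in (0:ℝ)..x, G n t) (Icc 0 1) :=
    fun n => continuousOn_primitive_unit (hGc n)
  have hSB : ∀ x ∈ Icc (0:ℝ) 1, ‖∫ t in (0:ℝ)..x, g t‖ ≤ max B₀ 0 :=
    fun x hx => norm_integral_le_of_le_unit hB0 hB hx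
  have hSnS : ∀ n, ∀ x ∈ Icc (0:ℝ) 1,
      ‖(∫ t in (0:ℝ)..x, G n t) - ∫ t in (0:ℝ)..x, g t‖ ≤ d n := fun n x hx => by
    rw [← intervalIntegral.integral_sub (intervalIntegrable_mono_unit (hGi n) hx)
      (intervalIntegrable_mono_unit hgi hx)]
    exact norm_integral_le_of_le_unit (hd0 n) (hGg n) hx
  -- the six limits
  have L1 : Tendsto (fun n => ∫ x in (0:ℝ)..1, ‖h n x‖ ^ 2) atTop
      (𝓝 (∫ x in (0:ℝ)..1, ‖g' x‖ ^ 2)) := by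
    have hN0 : 0 ≤ ∫ x in (0:ℝ)..1, ‖g' x‖ ^ 2 :=
      intervalIntegral.integral_nonneg zero_le_one fun x _ => sq_nonneg _
    obtain ⟨t, ht_def⟩ : ∃ t : ℕ → ℝ, ∀ n, t n = Real.sqrt (e n) + 1 / ((n:ℝ) + 1) :=
      ⟨_, fun _ => rfl⟩
    have ht0 : ∀ n, 0 < t n := fun n => by
      rw [ht_def]; exact add_pos_of_nonneg_of_pos (Real.sqrt_nonneg _) (by positivity)
    have ht_t : Tendsto t atTop (𝓝 0) := by
      have := hsqrt_t.add (tendsto_one_div_add_atTop_nhds_zero_nat (𝕜 := ℝ))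
      rw [add_zero] at this
      exact this.congr fun n => (ht_def n).symm
    have hh2i : ∀ n, IntervalIntegrable (fun x => ‖h n x‖ ^ 2) volume 0 1 :=
      fun n => ((hc n).norm.pow 2).intervalIntegrable 0 1
    have hbd : Tendsto (fun n => e n + Real.sqrt (e n) + t n * ∫ x in (0:ℝ)..1, ‖g' x‖ ^ 2)
        atTop (𝓝 0) := by
      simpa using (he_t.add hsqrt_t).add (ht_t.mul (tendsto_const_nhds
        (x := ∫ x in (0:ℝ)..1, ‖g' x‖ ^ 2)))
    rw [tendsto_iff_norm_sub_tendsto_zero]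
    refine squeeze_zero (fun n => norm_nonneg _) (fun n => ?_) hbd
    rw [← intervalIntegral.integral_sub (hh2i n) hg.intervalIntegrable_sq]
    have hpt : ∀ x ∈ Icc (0:ℝ) 1, ‖‖h n x‖ ^ 2 - ‖g' x‖ ^ 2‖
        ≤ (1 + 1 / t n) * ‖h n x - g' x‖ ^ 2 + t n * ‖g' x‖ ^ 2 := by
      intro x _
      have hab : |‖h n x‖ - ‖g' x‖| ≤ ‖h n x - g' x‖ := abs_norm_sub_norm_le _ _
      have hs : ‖h n x‖ ≤ ‖h n x - g' x‖ + ‖g' x‖ := by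
        calc ‖h n x‖ = ‖(h n x - g' x) + g' x‖ := by rw [sub_add_cancel]
          _ ≤ ‖h n x - g' x‖ + ‖g' x‖ := norm_add_le _ _
      have key : |‖h n x‖ ^ 2 - ‖g' x‖ ^ 2|
          ≤ ‖h n x - g' x‖ ^ 2 + 2 * (‖h n x - g' x‖ * ‖g' x‖) := by
        rw [sq_sub_sq, abs_mul, abs_of_nonneg (by positivity : 0 ≤ ‖h n x‖ + ‖g' x‖)]
        calc (‖h n x‖ + ‖g' x‖) * |‖h n x‖ - ‖g' x‖|
            ≤ (‖h n x - g' x‖ + 2 * ‖g' x‖) * ‖h n x - g' x‖ :=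
              mul_le_mul (by linarith) hab (abs_nonneg _) (by positivity)
          _ = _ := by ring
      have amgm : 2 * (‖h n x - g' x‖ * ‖g' x‖)
          ≤ ‖h n x - g' x‖ ^ 2 / t n + t n * ‖g' x‖ ^ 2 := by
        have ht := ht0 n
        rw [div_add' _ _ _ ht.ne', le_div_iff₀ ht]
        nlinarith [sq_nonneg (‖h n x - g' x‖ - t n * ‖g' x‖)]
      rw [Real.norm_eq_abs]
      calc _ ≤ _ := key
        _ ≤ ‖h n x - g' x‖ ^ 2 + (‖h n x - g' x‖ ^ 2 / t n + t n * ‖g' x‖ ^ 2) := by linarith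
        _ = (1 + 1 / t n) * ‖h n x - g' x‖ ^ 2 + t n * ‖g' x‖ ^ 2 := by ring
    have i1 : IntervalIntegrable
        (fun x => (1 + 1 / t n) * ‖h n x - g' x‖ ^ 2 + t n * ‖g' x‖ ^ 2) volume 0 1 :=
      ((hei n).const_mul _).add (hg.intervalIntegrable_sq.const_mul _)
    calc ‖∫ x in (0:ℝ)..1, (‖h n x‖ ^ 2 - ‖g' x‖ ^ 2)‖
        ≤ ∫ x in (0:ℝ)..1, ((1 + 1 / t n) * ‖h n x - g' x‖ ^ 2 + t n * ‖g' x‖ ^ 2) :=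
          intervalIntegral.norm_integral_le_of_norm_le zero_le_one
            (ae_of_all _ fun x hx => hpt x (Ioc_subset_Icc_self hx)) i1
      _ = (1 + 1 / t n) * e n + t n * ∫ x in (0:ℝ)..1, ‖g' x‖ ^ 2 := by
          rw [intervalIntegral.integral_add ((hei n).const_mul _)
              (hg.intervalIntegrable_sq.const_mul _),
            intervalIntegral.integral_const_mul, intervalIntegral.integral_const_mul, he_def]
      _ ≤ e n + Real.sqrt (e n) + t n * ∫ x in (0:ℝ)..1, ‖g' x‖ ^ 2 := by
          have hq : 1 / t n * e n ≤ Real.sqrt (e n) := by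
            rw [one_div, inv_mul_le_iff₀ (ht0 n)]
            calc e n = Real.sqrt (e n) * Real.sqrt (e n) := (Real.mul_self_sqrt (he0 n)).symm
              _ ≤ t n * Real.sqrt (e n) := by
                  refine mul_le_mul_of_nonneg_right ?_ (Real.sqrt_nonneg _)
                  rw [ht_def]; exact le_add_of_nonneg_right (by positivity)
          nlinarith [hq]
  have L2 : Tendsto (fun n => ∫ x in (0:ℝ)..1, h n x * conj (G n x)) atTop
      (𝓝 (∫ x in (0:ℝ)..1, g' x * conj (g x))) :=
    tendsto_intervalIntegral_mul_conj hhi hg'i hGc hgc (fun n => (hd_def n).symm.le) hd_t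
      hGg hd_t hB
  have L3 : Tendsto (fun n => ∫ x in (0:ℝ)..1, ‖G n x‖ ^ 2) atTop
      (𝓝 (∫ x in (0:ℝ)..1, ‖g x‖ ^ 2)) := by
    have L3c := tendsto_intervalIntegral_mul_conj hGi hgi hGc hgc hGg1 hd_t hGg hd_t hB
    have := (Complex.continuous_re.tendsto _).comp L3c
    simpa [Function.comp_def, integral_mul_conj_eq_ofReal] using this
  have L4 : Tendsto (fun n => ∫ x in (0:ℝ)..1, G n x * conj (∫ t in (0:ℝ)..x, G n t)) atTop
      (𝓝 (∫ x in (0:ℝ)..1, g x * conj (∫ t in (0:ℝ)..x, g t))) :=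
    tendsto_intervalIntegral_mul_conj hGi hgi hSnc hSc hGg1 hd_t hSnS hd_t hSB
  have L5 : Tendsto (fun n => ∫ x in (0:ℝ)..1, G n x) atTop (𝓝 (∫ x in (0:ℝ)..1, g x)) :=
    tendsto_intervalIntegral_of_norm_sub_le hGi hgi hGg1 hd_t
  have L6 : Tendsto (fun n => G n 1) atTop (𝓝 (g 1)) := by
    rw [tendsto_iff_norm_sub_tendsto_zero]
    exact squeeze_zero (fun n => norm_nonneg _) (fun n => hGg n 1 h1) hd_t
  -- assembly
  have hlim : Tendsto (fun n => mainTermForm (G n) (h n)) atTop (𝓝 (mainTermForm g g')) := by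
    simp only [mainTermForm_eq, hG0]
    refine Tendsto.add (Tendsto.sub (Tendsto.add (Tendsto.add (Tendsto.add ?_ ?_) ?_) ?_) ?_) ?_
    · exact L1.const_mul _
    · exact ((Complex.continuous_im.tendsto _).comp L2).const_mul _
    · exact L3.const_mul _
    · exact ((Complex.continuous_im.tendsto _).comp L4).const_mul _
    · exact ((Complex.continuous_re.tendsto _).comp
        (((Complex.continuous_conj.tendsto _).comp L5).mul (tendsto_const_nhds.add L6))).const_mul _
    · exact ((Complex.continuous_im.tendsto _).comp
        (tendsto_const_nhds.mul ((Complex.continuous_conj.tendsto _).comp L6))).const_mul _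
  exact ge_of_tendsto' hlim fun n => mainTermForm_nonneg (hGC1 n)

/-- `𝔅 ≥ 0` for kinked profiles: `g` continuous on `[0,1]`, right-differentiable at every interior
point with `g′ ∈ L²(0,1)`. [folklore] -/
theorem mainTermForm_nonneg_of_hasDerivWithinAt_Ioi (hc : ContinuousOn g (Icc 0 1))
    (hd : ∀ x ∈ Ioo (0:ℝ) 1, HasDerivWithinAt g (g' x) (Ioi x) x)
    (hm : MemLp g' 2 (volume.restrict (Ioc (0:ℝ) 1))) : 0 ≤ mainTermForm g g' :=
  mainTermForm_nonneg_of_isH1 (isH1_of_hasDerivWithinAt_Ioi hc hd hm)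


/-- `𝔅 ≥ 0` for kinked profiles with a BOUNDED a.e.-measurable right derivative (the shape of the
manuscript's continuous piecewise poly×exp profiles). [folklore] -/
theorem mainTermForm_nonneg_of_bounded_rightDeriv (hc : ContinuousOn g (Icc 0 1))
    (hd : ∀ x ∈ Ioo (0:ℝ) 1, HasDerivWithinAt g (g' x) (Ioi x) x)
    (hmeas : AEStronglyMeasurable g' (volume.restrict (Ioc (0:ℝ) 1))) {C : ℝ}
    (hC : ∀ x ∈ Ioc (0:ℝ) 1, ‖g' x‖ ≤ C) : 0 ≤ mainTermForm g g' :=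
  mainTermForm_nonneg_of_hasDerivWithinAt_Ioi hc hd
    (MemLp.of_bound hmeas C ((ae_restrict_iff' measurableSet_Ioc).2 (ae_of_all _ hC)))

end Literature.NumberTheory.LFunctions.Zhang2022
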